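import Summits.AtomisticToContinuum.BoseEinsteinCondensation.Theses.BECPhaseQuadratureSumRule
import Literature.MathematicalPhysics.QuantumManyBody.BoseGasThermodynamicLimitRuelle

/-!
# Birth skeleton — crux `LongWaveStructureBound` (route `BECPhaseQuadratureSumRule`, item stmt-AtomisticToContinuum-12617)

Line: **second moment = pairs + singles, pairs from energy by localisation/convexity, energy from
the t-uniform Dyson upper bound.**  Writing `N_u = Σ_j χ_u(x_j)` for the periodised particle number
in the sliding box `Λ_u(ℓ) = u + [-ℓ/2, ℓ/2]³`, `ℓ = (K√(ρ a(v)))⁻¹`, one has for `ℓ < L` the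
identity `N_u² = Σ_{i ≠ j} χ_u(x_i)χ_u(x_j) + N_u` (the periodised indicator is `{0,1}`-valued),
and `∫_{cell} E_Ψ[N_u] du = N ℓ³` exactly (Tonelli + torus translation + normalisation).
The ordered-pair count `P = ∫_u E_Ψ[N_u(N_u-1)] du` of the torus minimiser `Ψ_t` of
`-ΣΔ + tΣv^per` is what the sliding-box energy localisation controls: box energies are
superadditive and (in the Gross–Pitaevskii boxes `ρ a ℓ² = K⁻²`) convex ≈ `4π a_t n(n-1)/ℓ³`,
so `4π a_t ℓ⁻⁶ · P ≲ (1+η) E₀(t·v) + η·4π a_t ρ N`; and `E₀(t·v) ≤ 4π a_t ρ N (1+η)` uniformly in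
`t ∈ (0,1]` is Dyson's upper bound made uniform along the coupling path (Born regime as `t → 0`,
monotonicity + continuity of `t ↦ a(t v)` on `[t₀, 1]`).  Dividing out `4π a_t ℓ⁻⁶` and using
`ρ ℓ³ → ∞` (many particles per box, so the singles `N ℓ³` are an `ε`-fraction) gives the crux.

Stubs (sorried, registered): `stub_uniformDysonUpperBound` (S1, M/L), `stub_localizedConvexityPairBound`
(S2, L — load-bearing), `stub_diagonalExtraction` (S3, M), asserting the named statements
`UniformDysonUpperBound`, `LocalizedConvexityPairBound`, `DiagonalExtraction` (audit aliases `Goal.stub_*`).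
Composition `LongWaveStructureBound_of (h1 : Goal.stub_…) … : <crux by name>` is proved (no sorry), and
`LongWaveStructureBound_proof` applies it to the stubs: choice `η = min 1 (ε/8)`, density threshold `ρ < ε²/(4K⁶a³)` for
`N ℓ³ ≤ (ε/2)(ρℓ³)² L³`, the three eventualities in `N`, and the `ℝ≥0∞`/real algebra
`(1+η)ℓ⁶/(4πa_t) · 4πa_tρN(1+η) ≤ (1+η)²ρNℓ⁶` (degenerate `a_t = 0` included: real `x/0 = 0`).

Disproof used: none on file for this crux (`ledger crux ls`: no Disproof.lean at registration).
Known risk carried by S2 (docstring): near-minimisers with rare clusters violate any energy-only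
bound on the *uncapped* pair count, so S2 must use exact minimality beyond the energy value.
-/

namespace Summit.AtomisticToContinuum.BoseEinsteinCondensation.Cruxes.LongWaveStructureBound.Birth

open scoped BigOperators ENNReal NNReal Topology
open Filter MeasureTheory
open Literature.MathematicalPhysics.QuantumManyBody.BoseGas

/-! ### Stub statements (named `Prop`s; the registered stubs below assert them) -/

/-- **S1 — t-uniform Dyson upper bound.**  Along the coupling path `w = t·v`, `t ∈ (0,1]`, the periodic
ground-state energy at density `ρ < ρ₀(η)` satisfies `E₀(t·v, N, L) ≤ 4π a(t·v) ρ N (1+η)` for all large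
`N`, with ONE threshold `N₀` for all `t`.  For fixed `t` this is `LSSY2005_upperBound_periodic_holds`
(LSSY Thm 2.2, (2.14), constants depending on `R₀/a(t·v)`); uniformity: for `t ≤ t₀(η)` the constant
trial state and the Born series `4π a(t v) = ½ t∫v - O(t²)` give the bound with room `η` (ratio
`1 - 1/N`); on `[t₀, 1]` use monotonicity of `t ↦ E₀(t v)` and `t ↦ a(t v)` (`scatteringLength_mono`)
and continuity (concavity) of `t ↦ a(t v)` on a finite grid.  Why it might fail: only through the
`t → 0` corner (LSSY constants ∝ `R₀/a(tv)`), which the Born-regime argument is meant to cover. [size M/L] -/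
def UniformDysonUpperBound : Prop :=
  ∀ v : ℝ → ENNReal, IsRepulsiveFiniteRange v → (∀ r, v r ≠ ⊤) → ContDiff ℝ 2 (fun x : Space => (v ‖x‖).toReal) → (∃ Cₑ : ℝ, ∀ x : Space, ‖iteratedFDeriv ℝ 2 (fun x : Space => (v ‖x‖).toReal) x‖ ≤ Cₑ * Real.sqrt ((v ‖x‖).toReal)) → ∀ η : ℝ, 0 < η → ∃ ρ₀ : ℝ, 0 < ρ₀ ∧ ∀ ρ : ℝ, 0 < ρ → ρ < ρ₀ → ∀ᶠ N : ℕ in Filter.atTop, ∀ t : ℝ, 0 < t → t ≤ 1 → (let L : ℝ := sideLength ρ N; let w : ℝ → ENNReal := fun r => ENNReal.ofReal t * v r; periodicGroundStateEnergy w N L ≤ ENNReal.ofReal (4 * Real.pi * (scatteringLength w).toReal * ρ * N * (1 + η)))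

/-- **S2 — localised convexity bound on the ordered-pair count** (load-bearing).  For the exact torus
minimiser `Ψ` of `-ΣΔ + tΣv^per` (`t ∈ (0,1]`, `L = (N/ρ)^(1/3)`, `ρ < ρ₀(K, η)`, `N ≥ N₀` uniformly in
`t`), the `u`-averaged ordered-pair count `P` in the periodised sliding boxes `Λ_u(ℓ)`,
`ℓ = (K√(ρ a(v)))⁻¹`, obeys `P ≤ (1+η) ℓ⁶ E(Ψ)/(4π a(t v)) + η (ρℓ³)² L³` (real division; for
`a(tv) = 0` the potential vanishes a.e., `a(v) = 0`, `ℓ = 0` and `P = 0`).  Mechanism: sliding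
localisation of the energy into boxes of side `ℓ` (Fournais2020 Thm 2.1 / `Fournais2020_thm21_bdd_holds`,
LSY Neumann boxes), superadditivity and convexity of the box energy `e(n) ≳ 4π a_t n(n-1)/ℓ³` in the
GP boxes (`ρ a ℓ² = K⁻²`; Temple regime reached by subdividing, Cauchy–Schwarz recombines), which
converts the energy into a bound on `Σ_boxes E[n(n-1)]`, i.e. on `P`.  Why it might fail: the available
box bounds grow only linearly in `n` beyond a cap, so the UNCAPPED second moment needs tail control of
box occupations under the exact ground state (near-minimisers with rare clusters break it — minimality
must be used beyond the energy value); constants must be uniform on the `K`-grid and in `t`. [size L] -/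
def LocalizedConvexityPairBound : Prop :=
  ∀ v : ℝ → ENNReal, IsRepulsiveFiniteRange v → (∀ r, v r ≠ ⊤) → ContDiff ℝ 2 (fun x : Space => (v ‖x‖).toReal) → (∃ Cₑ : ℝ, ∀ x : Space, ‖iteratedFDeriv ℝ 2 (fun x : Space => (v ‖x‖).toReal) x‖ ≤ Cₑ * Real.sqrt ((v ‖x‖).toReal)) → ∀ K : ℝ, 0 < K → ∀ η : ℝ, 0 < η → ∃ ρ₀ : ℝ, 0 < ρ₀ ∧ ∀ ρ : ℝ, 0 < ρ → ρ < ρ₀ → ∀ᶠ N : ℕ in Filter.atTop, ∀ t : ℝ, 0 < t → t ≤ 1 → ∀ Ψ : PeriodicTrialState N (sideLength ρ N), (let L : ℝ := sideLength ρ N; let w : ℝ → ENNReal := fun r => ENNReal.ofReal t * v r; periodicEnergy w Ψ = periodicGroundStateEnergy w N L → periodicEnergy w Ψ ≠ ⊤ → (let ℓ : ℝ := (K * Real.sqrt (ρ * (scatteringLength v).toReal))⁻¹; (∫⁻ u in cell L, ∫⁻ X in cellN N L, (∑ i : Fin N, ∑ j : Fin N with j ≠ i, (∑' m : Fin 3 →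 ℤ, (slidingBox ℓ u).indicator (fun _ => (1 : ENNReal)) (X i + latticeVec L m)) * (∑' m : Fin 3 → ℤ, (slidingBox ℓ u).indicator (fun _ => (1 : ENNReal)) (X j + latticeVec L m))) * (‖Ψ.ψ X‖₊ : ENNReal) ^ 2) ≤ ENNReal.ofReal ((1 + η) * ℓ ^ 6 / (4 * Real.pi * (scatteringLength w).toReal)) * periodicEnergy w Ψ + ENNReal.ofReal (η * (ρ * ℓ ^ 3) ^ 2 * L ^ 3)))

/-- **S3 — diagonal extraction.**  For `0 ≤ ℓ < L` and every periodic trial state, the sliding second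
moment splits as ordered pairs + singles: pointwise `(Σ_j χ_j)² = Σ_{i≠j} χ_i χ_j + Σ_j χ_j²` with
`χ_j = Σ_m 1_{Λ_u(ℓ)}(x_j + Lm) ∈ {0,1}` when `ℓ < L` (two lattice translates of a closed cube of side
`ℓ < L` are disjoint), and `∫_{cell L} χ_j du = ℓ³` for every `x_j` (the cube injects into the torus),
so by Tonelli and `∫_{cell^N} |Ψ|² = 1` the singles contribute exactly `N ℓ³`.  Why it might fail:
only by measurability/Tonelli bookkeeping; stated as `≤`. [size M] -/
def DiagonalExtraction : Prop :=
  ∀ N : ℕ, ∀ L ℓ : ℝ, 0 ≤ ℓ → ℓ < L → ∀ Ψ : PeriodicTrialState N L, (∫⁻ u in cell L, ∫⁻ X in cellN N L, (∑ j : Fin N, ∑' m : Fin 3 → ℤ, (slidingBox ℓ u).indicator (fun _ => (1 : ENNReal)) (X j + latticeVec L m)) ^ 2 * (‖Ψ.ψ X‖₊ : ENNReal) ^ 2) ≤ (∫⁻ u in cell L, ∫⁻ X in cellN N L, (∑ i : Fin N, ∑ j : Fin N with j ≠ i, (∑' m : Fin 3 → ℤ, (slidingBox ℓ u).indicator (fun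 _ => (1 : ENNReal)) (X i + latticeVec L m)) * (∑' m : Fin 3 → ℤ, (slidingBox ℓ u).indicator (fun _ => (1 : ENNReal)) (X j + latticeVec L m))) * (‖Ψ.ψ X‖₊ : ENNReal) ^ 2) + ENNReal.ofReal ((N : ℝ) * ℓ ^ 3)

/-! ### Audit names of the stub statements (hypotheses of the composition are these, by name) -/

namespace Goal
/-- Statement of S1 `stub_uniformDysonUpperBound`. -/
abbrev stub_uniformDysonUpperBound : Prop := UniformDysonUpperBound
/-- Statement of S2 `stub_localizedConvexityPairBound`. -/
abbrev stub_localizedConvexityPairBound : Prop := LocalizedConvexityPairBound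
/-- Statement of S3 `stub_diagonalExtraction`. -/
abbrev stub_diagonalExtraction : Prop := DiagonalExtraction
end Goal

/-! ### Registered stubs (the only `sorry`s of this file) -/

/-- S1 (M/L): the t-uniform Dyson upper bound — see `UniformDysonUpperBound`. -/
theorem stub_uniformDysonUpperBound : UniformDysonUpperBound := by
  sorry

/-- S2 (L, load-bearing): localised convexity bound on the pair count — see `LocalizedConvexityPairBound`. -/
theorem stub_localizedConvexityPairBound : LocalizedConvexityPairBound := by
  sorry

/-- S3 (M): second moment = pairs + singles — see `DiagonalExtraction`. -/
theorem stub_diagonalExtraction : DiagonalExtraction := by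
  sorry

/-! ### Proved helpers for the composition -/

/-- Many particles per box: with `ℓ = (K√(ρa))⁻¹` and `ρ < ε²/(4K⁶a³)` (or `a = 0`, when `ℓ = 0`),
the singles `N ℓ³` are at most `(ε/2)(ρℓ³)² L³` (`L³ = N/ρ`). -/
theorem singles_le {K ρ a ε L : ℝ} {N : ℕ} (hK : 0 < K) (hρ : 0 < ρ) (hε : 0 < ε) (ha : 0 ≤ a)
    (hL : L ^ 3 = N / ρ) (hsmall : a = 0 ∨ ρ < ε ^ 2 / (4 * K ^ 6 * a ^ 3)) :
    (N : ℝ) * (K * Real.sqrt (ρ * a))⁻¹ ^ 3 ≤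
      ε / 2 * (ρ * (K * Real.sqrt (ρ * a))⁻¹ ^ 3) ^ 2 * L ^ 3 := by
  rcases eq_or_lt_of_le ha with h0 | hpos
  · rw [← h0]
    simp
  · have hlt : ρ < ε ^ 2 / (4 * K ^ 6 * a ^ 3) := hsmall.resolve_left hpos.ne'
    have hK0 : K ≠ 0 := hK.ne'
    have ha0 : a ≠ 0 := hpos.ne'
    have hρ0 : ρ ≠ 0 := hρ.ne'
    have hN : (0 : ℝ) ≤ N := N.cast_nonneg
    set s : ℝ := Real.sqrt (ρ * a) with hs_def
    have hρa : 0 < ρ * a := mul_pos hρ hpos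
    have hs : 0 < s := Real.sqrt_pos.mpr hρa
    have hs2 : s ^ 2 = ρ * a := Real.sq_sqrt hρa.le
    have hden : (0 : ℝ) < 4 * K ^ 6 * a ^ 3 := by positivity
    have h1 : ρ * a < (ε / (2 * K ^ 3 * a)) ^ 2 := by
      rw [div_pow, lt_div_iff₀ (by positivity)]
      calc ρ * a * (2 * K ^ 3 * a) ^ 2 = ρ * (4 * K ^ 6 * a ^ 3) := by ring
        _ < ε ^ 2 / (4 * K ^ 6 * a ^ 3) * (4 * K ^ 6 * a ^ 3) := mul_lt_mul_of_pos_right hlt hden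
        _ = ε ^ 2 := by field_simp
    have hslt : s < ε / (2 * K ^ 3 * a) := by
      calc s = Real.sqrt (ρ * a) := hs_def
        _ < Real.sqrt ((ε / (2 * K ^ 3 * a)) ^ 2) := Real.sqrt_lt_sqrt hρa.le h1
        _ = ε / (2 * K ^ 3 * a) := Real.sqrt_sq (by positivity)
    have h2 : s * (2 * K ^ 3 * a) < ε := (lt_div_iff₀ (by positivity)).mp hslt
    have h3 : K ^ 3 * s * a ≤ ε / 2 := by nlinarith [h2]
    set q : ℝ := (K * s)⁻¹ with hq_def
    have hq : 0 < q := inv_pos.mpr (mul_pos hK hs)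
    have hKs : K * s = q⁻¹ := by rw [hq_def, inv_inv]
    have hkey0 : (K * s) ^ 3 ≤ ε / 2 * ρ := by
      calc (K * s) ^ 3 = K ^ 3 * s * s ^ 2 := by ring
        _ = ρ * (K ^ 3 * s * a) := by rw [hs2]; ring
        _ ≤ ρ * (ε / 2) := mul_le_mul_of_nonneg_left h3 hρ.le
        _ = ε / 2 * ρ := by ring
    have hq3 : 0 < q ^ 3 := by positivity
    have hone : (K * s) ^ 3 * q ^ 3 = 1 := by
      rw [hKs, inv_pow, inv_mul_cancel₀ hq3.ne']
    have hkey : 1 ≤ ε / 2 * ρ * q ^ 3 := by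
      calc (1 : ℝ) = (K * s) ^ 3 * q ^ 3 := hone.symm
        _ ≤ ε / 2 * ρ * q ^ 3 := mul_le_mul_of_nonneg_right hkey0 hq3.le
    calc (N : ℝ) * q ^ 3 = 1 * ((N : ℝ) * q ^ 3) := by ring
      _ ≤ ε / 2 * ρ * q ^ 3 * ((N : ℝ) * q ^ 3) :=
          mul_le_mul_of_nonneg_right hkey (mul_nonneg hN hq3.le)
      _ = ε / 2 * (ρ * q ^ 3) ^ 2 * ((N : ℝ) / ρ) := by
          rw [show ε / 2 * (ρ * q ^ 3) ^ 2 * ((N : ℝ) / ρ) =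
              ε / 2 * ρ * q ^ 3 * ((N : ℝ) * q ^ 3) * (ρ / ρ) by ring, div_self hρ0, mul_one]
      _ = ε / 2 * (ρ * q ^ 3) ^ 2 * L ^ 3 := by rw [hL]

/-- The `ℝ≥0∞`/real algebra of the composition, abstracted from the integrals. -/
theorem assemble {X P E E₀ : ℝ≥0∞} {ρ ℓ L a η ε : ℝ} {N : ℕ}
    (hρ : 0 < ρ) (hε : 0 < ε) (hη : 0 < η) (hη1 : η ≤ 1) (hη8 : η ≤ ε / 8)
    (ha : 0 ≤ a) (hL0 : 0 ≤ L) (hL : L ^ 3 = N / ρ)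
    (hsmall : (N : ℝ) * ℓ ^ 3 ≤ ε / 2 * (ρ * ℓ ^ 3) ^ 2 * L ^ 3)
    (h3 : X ≤ P + ENNReal.ofReal ((N : ℝ) * ℓ ^ 3))
    (h2 : P ≤ ENNReal.ofReal ((1 + η) * ℓ ^ 6 / (4 * Real.pi * a)) * E +
      ENNReal.ofReal (η * (ρ * ℓ ^ 3) ^ 2 * L ^ 3))
    (hE : E = E₀)
    (h1 : E₀ ≤ ENNReal.ofReal (4 * Real.pi * a * ρ * N * (1 + η))) :
    X ≤ ENNReal.ofReal ((1 + ε) * (ρ * ℓ ^ 3) ^ 2 * L ^ 3) := by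
  have hπ : 0 < Real.pi := Real.pi_pos
  have hπ0 : Real.pi ≠ 0 := Real.pi_ne_zero
  have hρ0 : ρ ≠ 0 := hρ.ne'
  have hN : (0 : ℝ) ≤ N := N.cast_nonneg
  have hM : 0 ≤ ρ * N * ℓ ^ 6 := by positivity
  -- (ρℓ³)² L³ = ρ N ℓ⁶
  have hI : (ρ * ℓ ^ 3) ^ 2 * L ^ 3 = ρ * N * ℓ ^ 6 := by
    rw [hL, show (ρ * ℓ ^ 3) ^ 2 * ((N : ℝ) / ρ) = ρ * N * ℓ ^ 6 * (ρ / ρ) by ring,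
      div_self hρ0, mul_one]
  -- the product term: (1+η)ℓ⁶/(4πa) · 4πaρN(1+η) ≤ (1+η)²ρNℓ⁶ (equality unless a = 0)
  have hreal : (1 + η) * ℓ ^ 6 / (4 * Real.pi * a) * (4 * Real.pi * a * ρ * N * (1 + η)) ≤
      (1 + η) ^ 2 * (ρ * N * ℓ ^ 6) := by
    rcases eq_or_lt_of_le ha with h0 | hpos
    · rw [← h0]
      simp only [mul_zero, div_zero, zero_mul]
      positivity
    · have ha0 : a ≠ 0 := hpos.ne'
      apply le_of_eq
      field_simp
  have hc₁ : 0 ≤ (1 + η) * ℓ ^ 6 / (4 * Real.pi * a) := by positivity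
  have hprod : ENNReal.ofReal ((1 + η) * ℓ ^ 6 / (4 * Real.pi * a)) * E ≤
      ENNReal.ofReal ((1 + η) ^ 2 * (ρ * N * ℓ ^ 6)) := by
    rw [hE]
    calc ENNReal.ofReal ((1 + η) * ℓ ^ 6 / (4 * Real.pi * a)) * E₀
        ≤ ENNReal.ofReal ((1 + η) * ℓ ^ 6 / (4 * Real.pi * a)) *
            ENNReal.ofReal (4 * Real.pi * a * ρ * N * (1 + η)) := mul_le_mul' le_rfl h1
      _ = ENNReal.ofReal ((1 + η) * ℓ ^ 6 / (4 * Real.pi * a) *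
            (4 * Real.pi * a * ρ * N * (1 + η))) := (ENNReal.ofReal_mul hc₁).symm
      _ ≤ ENNReal.ofReal ((1 + η) ^ 2 * (ρ * N * ℓ ^ 6)) := ENNReal.ofReal_le_ofReal hreal
  have hcoef : (1 + η) ^ 2 + η ≤ 1 + 4 * η := by nlinarith [hη1, hη.le]
  have hP : P ≤ ENNReal.ofReal ((1 + 4 * η) * (ρ * N * ℓ ^ 6)) := by
    calc P ≤ _ := h2
      _ ≤ ENNReal.ofReal ((1 + η) ^ 2 * (ρ * N * ℓ ^ 6)) +
            ENNReal.ofReal (η * (ρ * ℓ ^ 3) ^ 2 * L ^ 3) := add_le_add hprod le_rfl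
      _ = ENNReal.ofReal ((1 + η) ^ 2 * (ρ * N * ℓ ^ 6) + η * (ρ * ℓ ^ 3) ^ 2 * L ^ 3) :=
            (ENNReal.ofReal_add (by positivity) (by positivity)).symm
      _ ≤ ENNReal.ofReal ((1 + 4 * η) * (ρ * N * ℓ ^ 6)) := by
            refine ENNReal.ofReal_le_ofReal ?_
            calc (1 + η) ^ 2 * (ρ * N * ℓ ^ 6) + η * (ρ * ℓ ^ 3) ^ 2 * L ^ 3
                = ((1 + η) ^ 2 + η) * (ρ * N * ℓ ^ 6) := by
                  rw [mul_assoc η ((ρ * ℓ ^ 3) ^ 2) (L ^ 3), hI]; ring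
              _ ≤ (1 + 4 * η) * (ρ * N * ℓ ^ 6) := mul_le_mul_of_nonneg_right hcoef hM
  calc X ≤ P + ENNReal.ofReal ((N : ℝ) * ℓ ^ 3) := h3
    _ ≤ ENNReal.ofReal ((1 + 4 * η) * (ρ * N * ℓ ^ 6)) +
          ENNReal.ofReal (ε / 2 * (ρ * ℓ ^ 3) ^ 2 * L ^ 3) :=
        add_le_add hP (ENNReal.ofReal_le_ofReal hsmall)
    _ = ENNReal.ofReal ((1 + 4 * η) * (ρ * N * ℓ ^ 6) + ε / 2 * (ρ * ℓ ^ 3) ^ 2 * L ^ 3) :=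
        (ENNReal.ofReal_add (by positivity) (by positivity)).symm
    _ ≤ ENNReal.ofReal ((1 + ε) * (ρ * ℓ ^ 3) ^ 2 * L ^ 3) := by
        refine ENNReal.ofReal_le_ofReal ?_
        calc (1 + 4 * η) * (ρ * N * ℓ ^ 6) + ε / 2 * (ρ * ℓ ^ 3) ^ 2 * L ^ 3
            = (1 + 4 * η + ε / 2) * (ρ * N * ℓ ^ 6) := by
              rw [mul_assoc (ε / 2) ((ρ * ℓ ^ 3) ^ 2) (L ^ 3), hI]; ring
          _ ≤ (1 + ε) * (ρ * N * ℓ ^ 6) := mul_le_mul_of_nonneg_right (by linarith) hM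
          _ = (1 + ε) * (ρ * ℓ ^ 3) ^ 2 * L ^ 3 := by
              rw [mul_assoc (1 + ε) ((ρ * ℓ ^ 3) ^ 2) (L ^ 3), hI]

/-! ### The composition (kernel-checked, no sorry) -/

/-- **Composition.** S1 → S2 → S3 → the crux `LongWaveStructureBound`, BY NAME (hypotheses = the
stub statements by their audit names `Goal.stub_*`; no sorry here). -/
theorem LongWaveStructureBound_of (h1 : Goal.stub_uniformDysonUpperBound)
    (h2 : Goal.stub_localizedConvexityPairBound) (h3 : Goal.stub_diagonalExtraction) :
    Summit.AtomisticToContinuum.BoseEinsteinCondensation.Theses.BECPhaseQuadratureSumRule.LongWaveStructureBound := by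
  have h1 : ∀ v : ℝ → ENNReal, IsRepulsiveFiniteRange v → (∀ r, v r ≠ ⊤) → ContDiff ℝ 2 (fun x : Space => (v ‖x‖).toReal) → (∃ Cₑ : ℝ, ∀ x : Space, ‖iteratedFDeriv ℝ 2 (fun x : Space => (v ‖x‖).toReal) x‖ ≤ Cₑ * Real.sqrt ((v ‖x‖).toReal)) → ∀ η : ℝ, 0 < η → ∃ ρ₀ : ℝ, 0 < ρ₀ ∧ ∀ ρ : ℝ, 0 < ρ → ρ < ρ₀ → ∀ᶠ N : ℕ in Filter.atTop, ∀ t : ℝ, 0 < t → t ≤ 1 → (let L : ℝ := sideLength ρ N; let w : ℝ → ENNReal := fun r => ENNReal.ofReal t * v r; periodicGroundStateEnergy w N L ≤ ENNReal.ofReal (4 * Real.pi * (scatteringLength w).toReal * ρ * N * (1 + η))) := h1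
  have h2 : ∀ v : ℝ → ENNReal, IsRepulsiveFiniteRange v → (∀ r, v r ≠ ⊤) → ContDiff ℝ 2 (fun x : Space => (v ‖x‖).toReal) → (∃ Cₑ : ℝ, ∀ x : Space, ‖iteratedFDeriv ℝ 2 (fun x : Space => (v ‖x‖).toReal) x‖ ≤ Cₑ * Real.sqrt ((v ‖x‖).toReal)) → ∀ K : ℝ, 0 < K → ∀ η : ℝ, 0 < η → ∃ ρ₀ : ℝ, 0 < ρ₀ ∧ ∀ ρ : ℝ, 0 < ρ → ρ < ρ₀ → ∀ᶠ N : ℕ in Filter.atTop, ∀ t : ℝ, 0 < t → t ≤ 1 → ∀ Ψ : PeriodicTrialState N (sideLength ρ N), (let L : ℝ := sideLength ρ N; let w : ℝ → ENNReal := fun r => ENNReal.ofReal t * v r; periodicEnergy w Ψ = periodicGroundStateEnergy w N L → periodicEnergy w Ψ ≠ ⊤ → (let ℓ : ℝ := (K * Real.sqrt (ρ * (scatteringLength v).toReal))⁻¹; (∫⁻ u in cell L, ∫⁻ X in cellN N L, (∑ i : Fin N, ∑ j : Fin N with j ≠ i, (∑' m : Fin 3 → ℤ, (slidingBox ℓ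 u).indicator (fun _ => (1 : ENNReal)) (X i + latticeVec L m)) * (∑' m : Fin 3 → ℤ, (slidingBox ℓ u).indicator (fun _ => (1 : ENNReal)) (X j + latticeVec L m))) * (‖Ψ.ψ X‖₊ : ENNReal) ^ 2) ≤ ENNReal.ofReal ((1 + η) * ℓ ^ 6 / (4 * Real.pi * (scatteringLength w).toReal)) * periodicEnergy w Ψ + ENNReal.ofReal (η * (ρ * ℓ ^ 3) ^ 2 * L ^ 3))) := h2
  have h3 : ∀ N : ℕ, ∀ L ℓ : ℝ, 0 ≤ ℓ → ℓ < L → ∀ Ψ : PeriodicTrialState N L, (∫⁻ u in cell L, ∫⁻ X in cellN N L, (∑ j : Fin N, ∑' m : Fin 3 → ℤ, (slidingBox ℓ u).indicator (fun _ => (1 : ENNReal)) (X j + latticeVec L m)) ^ 2 * (‖Ψ.ψ X‖₊ : ENNReal) ^ 2) ≤ (∫⁻ u in cell L, ∫⁻ X in cellN N L, (∑ i : Fin N, ∑ j : Fin N with j ≠ i, (∑' m : Fin 3 → ℤ, (slidingBox ℓ u).indicator (fun _ => (1 : ENNReal)) (X i + latticeVec L m)) * (∑' m : Fin 3 → ℤ,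 (slidingBox ℓ u).indicator (fun _ => (1 : ENNReal)) (X j + latticeVec L m))) * (‖Ψ.ψ X‖₊ : ENNReal) ^ 2) + ENNReal.ofReal ((N : ℝ) * ℓ ^ 3) := h3
  intro v hv hfin hC2 hedge K hK ε hε
  have hη : 0 < min 1 (ε / 8) := lt_min one_pos (by positivity)
  have hη1 : min 1 (ε / 8) ≤ 1 := min_le_left _ _
  have hη8 : min 1 (ε / 8) ≤ ε / 8 := min_le_right _ _
  obtain ⟨ρ₁, hρ₁, H1⟩ := h1 v hv hfin hC2 hedge (min 1 (ε / 8)) hη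
  obtain ⟨ρ₂, hρ₂, H2⟩ := h2 v hv hfin hC2 hedge K hK (min 1 (ε / 8)) hη
  have ha : 0 ≤ (scatteringLength v).toReal := ENNReal.toReal_nonneg
  obtain ⟨ρ₄, hρ₄, H4⟩ : ∃ ρ₄ : ℝ, 0 < ρ₄ ∧ ∀ ρ : ℝ, ρ < ρ₄ →
      ((scatteringLength v).toReal = 0 ∨
        ρ < ε ^ 2 / (4 * K ^ 6 * (scatteringLength v).toReal ^ 3)) := by
    rcases eq_or_lt_of_le ha with h0 | hpos
    · exact ⟨1, one_pos, fun ρ _ => Or.inl h0.symm⟩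
    · exact ⟨ε ^ 2 / (4 * K ^ 6 * (scatteringLength v).toReal ^ 3), by positivity,
        fun ρ h => Or.inr h⟩
  refine ⟨min ρ₁ (min ρ₂ ρ₄), lt_min hρ₁ (lt_min hρ₂ hρ₄), fun ρ hρ hρlt => ?_⟩
  have hρ1 : ρ < ρ₁ := hρlt.trans_le (min_le_left _ _)
  have hρ2 : ρ < ρ₂ := hρlt.trans_le ((min_le_right _ _).trans (min_le_left _ _))
  have hρ4 : ρ < ρ₄ := hρlt.trans_le ((min_le_right _ _).trans (min_le_right _ _))
  have hℓ : 0 ≤ (K * Real.sqrt (ρ * (scatteringLength v).toReal))⁻¹ :=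
    inv_nonneg.mpr (mul_nonneg hK.le (Real.sqrt_nonneg _))
  filter_upwards [H1 ρ hρ hρ1, H2 ρ hρ hρ2,
    (tendsto_sideLength_atTop hρ).eventually_gt_atTop
      (K * Real.sqrt (ρ * (scatteringLength v).toReal))⁻¹] with N hN1 hN2 hN3
  intro t ht ht1 Ψ
  dsimp only
  intro hmin hfinE
  have h1' := hN1 t ht ht1
  have h2' := hN2 t ht ht1 Ψ
  try dsimp only at h1'
  try dsimp only at h2'
  have h2'' := h2' hmin hfinE
  have h3' := h3 N (sideLength ρ N) _ hℓ hN3 Ψ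
  exact assemble hρ hε hη hη1 hη8 ENNReal.toReal_nonneg (sideLength_nonneg hρ.le N)
    (sideLength_pow_three hρ N) (singles_le hK hρ hε ha (sideLength_pow_three hρ N) (H4 ρ hρ4))
    h3' h2'' hmin h1'

/-- The skeleton applied to the (sorried) stubs: the crux modulo exactly S1, S2, S3. -/
theorem LongWaveStructureBound_proof :
    Summit.AtomisticToContinuum.BoseEinsteinCondensation.Theses.BECPhaseQuadratureSumRule.LongWaveStructureBound :=
  LongWaveStructureBound_of stub_uniformDysonUpperBound stub_localizedConvexityPairBound
    stub_diagonalExtraction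

end Summit.AtomisticToContinuum.BoseEinsteinCondensation.Cruxes.LongWaveStructureBound.Birth
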